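import Literature.MathematicalPhysics.QuantumFieldTheory.Balaban1983to89.BlockAveragingEMLFibreLawSUN
import Literature.MathematicalPhysics.QuantumFieldTheory.Balaban1983to89.T4FiniteEpsInhabited
import Literature.MathematicalPhysics.QuantumFieldTheory.Balaban1983to89.B12RTGaugeInvariance254
import Literature.MathematicalPhysics.QuantumFieldTheory.Balaban1983to89.B12Eq019ActionBody

/-!
# `Balaban1983to89.B12RT013TwoLevel` — [Balaban1987RG1] (0.13) p. 254 and (0.17)–(0.19) p. 255 AT THE PAPER'S OWN
# AVERAGING (0.11)–(0.12): the renormalization transformation `T_k` as an `RTOpI`, hypothesis-free on `SU(N)`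

HONEST FRAMING (cell `lit-balaban`, verbatim): statement-level skeleton of published theorems with citation tags;
proofs where landed; nothing here is a claim about the Yang–Mills mass gap.

CITATION HEADER.  T. Bałaban, *Renormalization group approach to lattice gauge field theories. I. Generation of
effective actions in a small field approximation and a coupling constant renormalization in four dimensions*,
Commun. Math. Phys. **109** (1987) 249–301 [Balaban1987RG1] (cell paper B12 = "[I]"), pp. 253–255; held text
`paper:balaban1987-cmp109-rg-i-small-field` pp. 6–7 re-read by this seat (2026-08-23), displays against the reader row
cells B12.Eq0.11 / Eq0.12 / Eq0.13 / Eq0.17 / Eq0.19 of `HOME/lit-balaban-r09/ROWS-B12.md` (render-checked v2.75/v2.76).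

WHAT IS QUOTED.  p. 254: «Now we consider renormalization transformations, which have the general form
(Tρ)(V) = ∫dU t(V,U)ρ(U). (0.13) Here U, V are gauge field configurations on the lattices T, T⁽¹⁾ correspondingly, and
t(V,U) is a gauge invariant kernel, for example see the definitions in [9,12]. … The kernel t(V,U) introduces connections
between fields U and V, like the equalities Ū = V in the definitions of [9,16] … In order to maintain the Euclidean
invariance on the lattice T⁽¹⁾ we have to use other expressions than the contour variables U(Γ_{y,x}). We use the
variables U(y,x) defined in (0.11).»  p. 255: «In the first step we define
A₁(V) = (𝐓₀A)(V) = log 𝐍₀⁻¹ ∫dU Π_{c∈T⁽¹⁾} δ(Ū(c)V⁻¹(c)) χ₀ exp[−(1/g₀²) Σ_{y∈T⁽¹⁾} Σ_{x∈B(y),x≠y} [1 − Re tr U(y,x)]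
− (1/g₀²)A(U)] (0.17) where the normalization factor 𝐍₀ is given by the same integral as above, but with V = 1. … The
(k+1)-st action A_{k+1} is defined by the generalization of (0.17), [(0.19)]», with `Ū(c)` the two-level average (0.12)
p. 254 «Ū(c) = exp[i Σ_{x∈B(c₋)} L^{−d} (1/i) log U(c₋,x)U([x,x′])U(x′,c₊)U(−c)] U(c)» built from the averaged contour
variables (0.11) p. 253 «U(y,x) = M({U(Γ)}_{Γ∈G(y,x)})».

WHAT IS PROVED (definitions WITH BODIES + theorems; 0 `Prop`-facts).  The tree types (0.13) as an abstract OPERATOR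
(`Setup.RTOpI`: push-forward identity `Setup.IsRT` on integrable densities + positivity; cell DIVERGENCE F7/F17) and
(0.17)/(0.19) as the predicate `Setup.SmallFieldStepI T χ GF g_k A_k A_{k+1}` over such a `T`; the two-level averaging
(0.12) is the tree's `BlockAveragingTwoLevel.blockAvg₂ 𝓜 ℰ` (inner group average `𝓜` = print's axiomatic `M` of
(0.5)–(0.7), outer small-loop average `ℰ`, printed instance `ExpMeanLog.expMeanLogSU`), the variables (0.11) are
`BlockAveragingTwoLevel.contourData 𝓜`.  THIS MODULE SUPPLIES PRINT'S OWN INSTANCE of the abstract `T` and `GF`: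
* §1 `rtOpITwoLevel 𝓜 ℰ … : RTOpI P j G (blockAvg₂ 𝓜 ℰ)` — the δ-kernel transformation `∫dU Π_c δ(Ū(c)V⁻¹(c)) (·)` of
  (0.17)/(0.19) for `Ū` = (0.12), realised as the Radon–Nikodym transport `AveragingRT.rnTransport (avgFun₂ 𝓜 ℰ)` of
  `ρ dU` under `Ū` (the pub-balaban cell's `T4FiniteEpsInhabited.rtOpIOfAC`) under the bracket
  `T4FiniteEpsInhabited.HaarAC (avgFun₂ 𝓜 ℰ)` — general compact `G`, any `𝓜`, `ℰ`; `isRT_rtOpITwoLevel` (print's δ-function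
  definition in the weak form `∫dV (Tρ)(V) f(V) = ∫dU ρ(U) f(Ū)`), positivity; the level family `rtOpITwoLevelStd` over
  `blockAvg₂Std` (= (0.12) in the standing range `k + 1 ≤ m + K`, the transport averaging beyond it, as in the one-level
  precedent `B10Eq2DensityTower.rtOpIBlockAvgStd`).
* §2 HYPOTHESIS-FREE ON `SU(N)`, EVERY `N ≥ 1`, for the printed outer exp-mean-log average and ANY measurable inner `M`
  (`rtOpITwoLevelSUN`), in particular Federbush's inner mean (0.10) (`rtOpITwoLevelFederbush`), by
  `BlockAveragingEMLFibreLawSUN.haarAC_avgFun₂_expMeanLogSU_SUN` / `haarAC_avgFun₂_federbushSU_expMeanLogSU`; the whole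
  level family is inhabited (`nonempty_rtOpI_family_federbush`).
* §3 the gauge-fixing density of (0.17) with `U(y,x)` = (0.11): `gf017 𝓜 Y := Setup.gaugeFixFn (contourData 𝓜) Y`
  (lift-invariant under block-constant gauge transformations, `liftInvariant_gf017`, by
  `B12RTGaugeInvariance254.liftInvariant_gaugeFixFn`; `0 ≤ gf017`).
* §5 **(0.19) LITERALLY, AT THE PAPER'S OWN OBJECTS** — composing the BODY of `A_{k+1}` (r20's `B12Eq019ActionBody.nextAction`,
  landed p363008: `A_{k+1}(V) := log 𝐍_k⁻¹ (T(χ_k e^{−GF/g_k² + A_k}))(V)` over an abstract operator `T`) with print's `T_k` of §1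
  and print's `𝐆` of §3: `printedNextAction 𝓜 ℰ … χ g_k A_k := nextAction (rtOpITwoLevel 𝓜 ℰ …).T χ (gf017 𝓜 univ) g_k A_k`
  — `A_{k+1}(g_{k+1},V) = log 𝐍_k⁻¹ ∫dU Π_c δ(Ū(c)V⁻¹(c)) χ_k exp[−(1/g_k²)Σ_yΣ_{x∈B(y),x≠y}[1 − Re tr U(y,x)] + A_k(g_k,U)]` with
  `Ū` = (0.12), `U(y,x)` = (0.11), the δ-integral in the Radon–Nikodym reading (`printedNextAction_apply`, `rfl`);
  `printedNextAction_one` (`A_{k+1}(1) = 0`), `smallFieldStepI_printedNextAction` (positivity of the transformed density ⇒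
  the cell's step predicate HOLDS at print's objects with this `A_{k+1}`), `eq_printedNextAction_of_step` (and is FORCED: any
  `A'` satisfying the step at print's objects IS `printedNextAction`); hypothesis-free `SU(N)` forms `printedNextActionSUN`,
  `printedNextActionFederbush` (both printed averaging operations).
* §4 (0.17)/(0.19) AT THESE OBJECTS: `smallFieldStepI_twoLevel_iff` (the predicate unfolded to the Radon–Nikodym
  transport, `Iff.rfl`); `exists_integral_step_eq` — THE WEAK (δ-FUNCTION) FORM of the printed display: if the step holds
  then `∃ N_k > 0, A_{k+1}(1) = 0 ∧ ∀ f` bounded measurable,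
  `N_k ∫dV e^{A_{k+1}(V)} f(V) = ∫dU χ_k(U) e^{−𝐆(U)/g_k² + A_k(U)} f(Ū)`, i.e. print's
  `e^{A_{k+1}(V)} 𝐍_k = ∫dU Π_c δ(Ū(c)V⁻¹(c)) χ_k e^{…}` integrated against test functions; `integral_step_mass`
  (f ≡ 1: `N_k ∫dV e^{A_{k+1}} = ∫dU χ_k e^{−𝐆/g_k² + A_k}`); `nextAction_gaugeInvariant_ae_twoLevel` — p. 265 / p. 263
  gauge invariance of `A_{k+1}` at print's `T` and print's `𝐆` (instance of
  `B12RTGaugeInvariance254.smallFieldStep_gaugeInvariant_ae` with `liftInvariant_gf017`).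

WHAT THIS IS NOT.  The BODY of `A_{k+1}` over an abstract operator is r20's `B12Eq019ActionBody` (imported, never
re-declared); this module supplies print's operator and gauge-fixing density and composes them (§5).  No integrability of
the printed densities is proved (hypotheses `hint`, `hint'`);
nothing on the coupling renormalization (0.18)/(0.20), on positivity of `T(χ_k e^{…})` (print takes its log), on the
representation (0.22) or on Theorems 1–3.  Off `SU(N)` the bracket `HaarAC` stays a hypothesis (named).  Every result is
elementary measure theory / bookkeeping ([folklore]) about the published formulas; the citations of (0.11)/(0.12) are
carried by `BlockAveragingTwoLevel`, of the transport by `AveragingRT` / `T4FiniteEpsInhabited`.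

DIVERGENCES (cell register, none new): F7 (δ-kernel RT in the push-forward / Radon–Nikodym reading: `(Tρ)(V)` is a
`dV`-a.e. defined version, not a pointwise δ-integral), F17 (`RTOpI`, integrable densities), F6 / D-pv26g2.3 (ii) (the
contour families of (0.11) indexed by orderings; identification with print's set averages `B12ContourMultiplicity252`),
the total extensions by gauge-invariant guards of `blockAvg₂` / `contourData` (`BlockAveragingTwoLevel`).
-/

noncomputable section

namespace Literature.MathematicalPhysics.QuantumFieldTheory.Balaban1983to89.B12RT013TwoLevel

open _root_.MeasureTheory
open Literature.MathematicalPhysics.QuantumFieldTheory.Balaban1983to89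
open AveragingRT BlockAveraging BlockAveragingTwoLevel T4FiniteEpsInhabited B12RTGaugeInvariance254

/-! ## 1. Print's `T` of (0.13)/(0.17)/(0.19) for the two-level averaging (0.12), general compact `G` -/

section General

variable {P : Params} {j : ℕ} {G : Type*} [GaugeGroup G] [MeasurableSpace G] [HaarData G] [RegularGaugeGroup G]
variable (𝓜 : GroupAverage G) (ℰ : LoopAverage G)

/-- **The renormalization transformation of [I] at the paper's own averaging**: the δ-kernel instance
`(T_kρ)(V) = ∫dU Π_{c∈T^{(k+1)}} δ(Ū(c)V⁻¹(c)) ρ(U)` of (0.13) used in (0.17)/(0.19), for `Ū` = the two-level average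
(0.12) `blockAvg₂ 𝓜 ℰ`, as an operator on integrable densities (`Setup.RTOpI`): the Radon–Nikodym transport of `ρ dU`
under `Ū` (`T4FiniteEpsInhabited.rtOpIOfAC`), under the absolute-continuity bracket `HaarAC (avgFun₂ 𝓜 ℰ)` and
measurability of the inner/outer averages. [cite: Balaban1987RG1, (0.13) p.254, (0.17) p.255] -/
def rtOpITwoLevel (hM : 𝓜.MeasurableM) (hE : ℰ.MeasurableE)
    (hac : HaarAC (avgFun₂ 𝓜 ℰ : GaugeField P j G → GaugeField P (j+1) G)) : RTOpI P j G (blockAvg₂ 𝓜 ℰ) :=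
  rtOpIOfAC (blockAvg₂ 𝓜 ℰ) (measurable_avgFun₂ 𝓜 ℰ hM hE) hac

variable {𝓜 ℰ}

/-- The operator IS the Radon–Nikodym transport under `Ū` = (0.12) (definitional). [cite: Balaban1987RG1, (0.13) p.254] -/
@[simp] theorem rtOpITwoLevel_T (hM : 𝓜.MeasurableM) (hE : ℰ.MeasurableE)
    (hac : HaarAC (avgFun₂ 𝓜 ℰ : GaugeField P j G → GaugeField P (j+1) G)) :
    (rtOpITwoLevel 𝓜 ℰ hM hE hac).T = rnTransport (avgFun₂ 𝓜 ℰ) := rfl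

/-- Print's δ-function definition in the weak form: `∫dV (T_kρ)(V) f(V) = ∫dU ρ(U) f(Ū)` for every integrable density `ρ`
and bounded measurable `f`, with `Ū` = (0.12). [cite: Balaban1987RG1, (0.13) p.254] -/
theorem isRT_rtOpITwoLevel (hM : 𝓜.MeasurableM) (hE : ℰ.MeasurableE)
    (hac : HaarAC (avgFun₂ 𝓜 ℰ : GaugeField P j G → GaugeField P (j+1) G))
    (ρ : Density P j G) (hρ : Integrable ρ (fieldMeasure P j G)) :
    IsRT (avgFun₂ 𝓜 ℰ) ρ ((rtOpITwoLevel 𝓜 ℰ hM hE hac).T ρ) :=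
  (rtOpITwoLevel 𝓜 ℰ hM hE hac).isRT ρ hρ

/-- Positivity: `ρ ≥ 0 ⇒ T_kρ ≥ 0` pointwise (the kernel `t(V,U)` of (0.13) is non-negative in every printed instance). [cite: Balaban1987RG1, (0.13) p.254] -/
theorem rtOpITwoLevel_nonneg (hM : 𝓜.MeasurableM) (hE : ℰ.MeasurableE)
    (hac : HaarAC (avgFun₂ 𝓜 ℰ : GaugeField P j G → GaugeField P (j+1) G))
    (ρ : Density P j G) (h0 : ∀ U, 0 ≤ ρ U) (V : GaugeField P (j+1) G) :
    0 ≤ (rtOpITwoLevel 𝓜 ℰ hM hE hac).T ρ V :=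
  (rtOpITwoLevel 𝓜 ℰ hM hE hac).pos ρ h0 V

variable (P G 𝓜 ℰ)

/-- The LEVEL FAMILY of averagings of [I]: the two-level averaging (0.12) at every level of the standing range
`k + 1 ≤ m + K` («we continue … until we reach the unit lattice», p. 256), the transport averaging `AveragingRT.stdAvg`
beyond it (where the tori of `Setup` have degenerated) — the two-level twin of `B10Eq2DensityTower.blockAvgStd`.
[cite: Balaban1987RG1, (0.12) p.254] -/
def blockAvg₂Std (k : ℕ) : Averaging P k G :=
  if k + 1 ≤ P.m + P.K then blockAvg₂ 𝓜 ℰ else stdAvg P G k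

variable {P G}

omit [MeasurableSpace G] [HaarData G] [RegularGaugeGroup G] in
/-- In the standing range the family IS (0.12). [cite: Balaban1987RG1, (0.12) p.254] -/
theorem blockAvg₂Std_of_le {k : ℕ} (hk : k + 1 ≤ P.m + P.K) : blockAvg₂Std P G 𝓜 ℰ k = blockAvg₂ 𝓜 ℰ := if_pos hk

omit [MeasurableSpace G] [HaarData G] [RegularGaugeGroup G] in
/-- Beyond the standing range the family is the transport averaging (plumbing twin of `B10Eq2DensityTower.blockAvgStd_of_not_le`). [cite: Balaban1987RG1, (0.12) p.254] -/
theorem blockAvg₂Std_of_not_le {k : ℕ} (hk : ¬ k + 1 ≤ P.m + P.K) : blockAvg₂Std P G 𝓜 ℰ k = stdAvg P G k :=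
  if_neg hk

omit [MeasurableSpace G] [HaarData G] [RegularGaugeGroup G] in
/-- In the standing range the averaging MAP of the family is `Ū` = (0.12). [cite: Balaban1987RG1, (0.12) p.254] -/
theorem blockAvg₂Std_avg_of_le {k : ℕ} (hk : k + 1 ≤ P.m + P.K) :
    (blockAvg₂Std P G 𝓜 ℰ k).avg = avgFun₂ 𝓜 ℰ := by
  rw [blockAvg₂Std_of_le 𝓜 ℰ hk]; rfl

variable (P G)

/-- **The renormalization transformations `T_k`, `k = 0, 1, …` of [I] for the paper's averaging, as a level family of
operators on integrable densities**: `rtOpITwoLevel` in the standing range (under the bracket `HaarAC` at every such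
level), `AveragingRT.rtOpIStd` beyond it. [cite: Balaban1987RG1, (0.13) p.254, (0.19) p.255] -/
def rtOpITwoLevelStd (hM : 𝓜.MeasurableM) (hE : ℰ.MeasurableE)
    (hac : ∀ k, k + 1 ≤ P.m + P.K → HaarAC (avgFun₂ 𝓜 ℰ : GaugeField P k G → GaugeField P (k+1) G))
    (k : ℕ) : RTOpI P k G (blockAvg₂Std P G 𝓜 ℰ k) where
  T := if k + 1 ≤ P.m + P.K then rnTransport (avgFun₂ 𝓜 ℰ) else (rtOpIStd P G k).T
  isRT := by
    intro ρ hρ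
    by_cases hk : k + 1 ≤ P.m + P.K
    · rw [if_pos hk, blockAvg₂Std_avg_of_le 𝓜 ℰ hk]
      exact isRT_rnTransport_of_ac (avgFun₂ 𝓜 ℰ) (measurable_avgFun₂ 𝓜 ℰ hM hE) (hac k hk) ρ hρ
    · rw [if_neg hk, blockAvg₂Std_of_not_le 𝓜 ℰ hk]
      exact (rtOpIStd P G k).isRT ρ hρ
  pos := by
    intro ρ h0 V
    by_cases hk : k + 1 ≤ P.m + P.K
    · rw [if_pos hk]
      exact rnTransport_nonneg _ ρ h0 V
    · rw [if_neg hk]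
      exact (rtOpIStd P G k).pos ρ h0 V

variable {P G}

/-- In the standing range the `k`-th operator of the family IS the Radon–Nikodym transport under (0.12), i.e. the operator
of `rtOpITwoLevel`. [cite: Balaban1987RG1, (0.13) p.254] -/
theorem rtOpITwoLevelStd_T_of_le (hM : 𝓜.MeasurableM) (hE : ℰ.MeasurableE)
    (hac : ∀ k, k + 1 ≤ P.m + P.K → HaarAC (avgFun₂ 𝓜 ℰ : GaugeField P k G → GaugeField P (k+1) G))
    {k : ℕ} (hk : k + 1 ≤ P.m + P.K) :
    (rtOpITwoLevelStd P G 𝓜 ℰ hM hE hac k).T = (rtOpITwoLevel 𝓜 ℰ hM hE (hac k hk)).T := by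
  show (if k + 1 ≤ P.m + P.K then _ else _) = _
  rw [if_pos hk]; rfl

end General

/-! ## 2. Hypothesis-free on `SU(N)`, every `N ≥ 1`: printed outer exp-mean-log, any measurable inner `M` -/

section SUN

open ExpMeanLog BlockAveragingEMLFibreLawSUN

variable {N : ℕ} [NeZero N] {P : Params} {j : ℕ}

/-- **Print's `T_k` on `SU(N)`, NO BRACKET**: for the two-level averaging (0.12) with the PRINTED outer exp-mean-log
operation `expMeanLogSU` and every inner group average `𝓜` with measurable `M`, at every level of the standing range —
`HaarAC` is the tree's theorem `BlockAveragingEMLFibreLawSUN.haarAC_avgFun₂_expMeanLogSU_SUN`. [cite: Balaban1987RG1, (0.13) p.254, (0.17) p.255] -/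
def rtOpITwoLevelSUN (𝓜 : GroupAverage (Matrix.specialUnitaryGroup (Fin N) ℂ)) (hM : 𝓜.MeasurableM)
    (hj : j + 1 ≤ P.m + P.K) :
    RTOpI P j (Matrix.specialUnitaryGroup (Fin N) ℂ) (blockAvg₂ 𝓜 expMeanLogSU) :=
  rtOpITwoLevel 𝓜 expMeanLogSU hM measurable_expMeanLogSU_E (haarAC_avgFun₂_expMeanLogSU_SUN 𝓜 hj hM)

/-- Its operator is the Radon–Nikodym transport under (0.12) (definitional). [cite: Balaban1987RG1, (0.13) p.254] -/
@[simp] theorem rtOpITwoLevelSUN_T (𝓜 : GroupAverage (Matrix.specialUnitaryGroup (Fin N) ℂ)) (hM : 𝓜.MeasurableM)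
    (hj : j + 1 ≤ P.m + P.K) :
    (rtOpITwoLevelSUN (P := P) 𝓜 hM hj).T = rnTransport (avgFun₂ 𝓜 expMeanLogSU) := rfl

/-- **Print's `T_k` with BOTH printed operations** — Federbush's inner mean (0.10) (`FederbushMean.federbushSU`) and the
exp-mean-log outer average of (0.12) — on `SU(N)`, every `N ≥ 1`, no bracket. [cite: Balaban1987RG1, (0.10) p.253, (0.13) p.254, (0.17) p.255] -/
def rtOpITwoLevelFederbush (hj : j + 1 ≤ P.m + P.K) :
    RTOpI P j (Matrix.specialUnitaryGroup (Fin N) ℂ)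
      (blockAvg₂ (FederbushMean.federbushSU (n := Fin N)) expMeanLogSU) :=
  rtOpITwoLevelSUN FederbushMean.federbushSU measurableM_federbushSU hj

/-- The level family of print's `T_k` on `SU(N)` for any measurable inner `M`, no bracket. [cite: Balaban1987RG1, (0.19) p.255] -/
def rtOpITwoLevelStdSUN (𝓜 : GroupAverage (Matrix.specialUnitaryGroup (Fin N) ℂ)) (hM : 𝓜.MeasurableM) (k : ℕ) :
    RTOpI P k (Matrix.specialUnitaryGroup (Fin N) ℂ) (blockAvg₂Std P _ 𝓜 expMeanLogSU k) :=
  rtOpITwoLevelStd P _ 𝓜 expMeanLogSU hM measurable_expMeanLogSU_E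
    (fun _ hk => haarAC_avgFun₂_expMeanLogSU_SUN 𝓜 hk hM) k

/-- **THE CARRIER OF THE PAPER'S RG TOWER IS INHABITED, hypothesis-free**: on `SU(N)`, every `N ≥ 1`, with the two printed
averaging operations, the pair (averaging family, family of renormalization transformations on integrable densities)
demanded by the tree's tower structures (`StepInhabited.GeneratedBySmallFieldRTI`, `Step.DensityRG`-type binders) exists
AT EVERY LEVEL («the sequence of actions … is defined for k = 0, 1, …, K», p. 256). [cite: Balaban1987RG1, (0.19) p.255] -/
theorem nonempty_rtOpI_family_federbush (P : Params) :
    Nonempty (∀ k, RTOpI P k (Matrix.specialUnitaryGroup (Fin N) ℂ)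
      (blockAvg₂Std P _ (FederbushMean.federbushSU (n := Fin N)) expMeanLogSU k)) :=
  ⟨rtOpITwoLevelStdSUN FederbushMean.federbushSU measurableM_federbushSU⟩

end SUN

/-! ## 3. The gauge-fixing density of (0.17) with the variables (0.11) -/

section GaugeFixing

variable {P : Params} {j : ℕ} {G : Type*} [GaugeGroup G]
variable (𝓜 : GroupAverage G)

/-- **The exponential gauge-fixing function of (0.17)/(0.19) at print's variables**: `𝐆(Y, U) = Σ_{y∈Y} Σ_{x∈B(y), x≠y}
[1 − Re tr U(y,x)]` with `U(y,x)` THE AVERAGED CONTOUR VARIABLES (0.11) («We use the variables U(y,x) defined in (0.11)»,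
p. 254) — the tree's `Setup.gaugeFixFn` at the contour data `BlockAveragingTwoLevel.contourData 𝓜`. [cite: Balaban1987RG1, (0.17) p.255, (0.11) p.253] -/
def gf017 (Y : Finset (Site P (j+1))) : Density P j G := gaugeFixFn (contourData 𝓜) Y

/-- Unfolding: `𝐆(Y,U) = Σ_{y∈Y} Σ_{x∈B(y),x≠y} [1 − Re tr U(y,x)]` with `U(y,x)` = (0.11). [cite: Balaban1987RG1, (0.17) p.255] -/
theorem gf017_apply (Y : Finset (Site P (j+1))) (U : GaugeField P j G) :
    gf017 𝓜 Y U = ∑ y ∈ Y, ∑ x ∈ (block y).erase (emb y), (1 - reTr ((contourData 𝓜).holTo U y x)) := rfl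

/-- `gf017` is lift-invariant: `𝐆(Y, U^{v∘blockOf}) = 𝐆(Y, U)` for block-constant gauge transformations (the residual
invariance «u(y) = 1 for y ∈ T⁽¹⁾» having been fixed, p. 254), by `B12RTGaugeInvariance254.liftInvariant_gaugeFixFn` at
print's contour data. [cite: Balaban1987RG1, (0.13) p.254] -/
theorem liftInvariant_gf017 (hj : j + 1 ≤ P.m + P.K) (Y : Finset (Site P (j+1))) : LiftInvariant (gf017 𝓜 Y : Density P j G) :=
  liftInvariant_gaugeFixFn hj (contourData 𝓜) Y

variable [MeasurableSpace G] [RegularGaugeGroup G]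

/-- `0 ≤ 𝐆(Y, U)` (each summand `1 − Re tr U(y,x) ≥ 0` of the exponential gauge fixing (0.14)/(0.17) is non-negative, `|Re tr| ≤ 1` in the model). [cite: Balaban1987RG1, (0.14) p.254] -/
theorem gf017_nonneg (Y : Finset (Site P (j+1))) (U : GaugeField P j G) : 0 ≤ gf017 𝓜 Y U := by
  rw [gf017_apply]
  refine Finset.sum_nonneg fun y _ => Finset.sum_nonneg fun x _ => ?_
  have h := RegularGaugeGroup.abs_reTr_le_one (G := G) ((contourData 𝓜).holTo U y x)
  rw [abs_le] at h
  linarith [h.2]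

end GaugeFixing

/-! ## 4. (0.17)/(0.19) at print's objects: the step unfolded, its weak (δ-function) form, gauge invariance -/

section Step

variable {P : Params} {j : ℕ} {G : Type*} [GaugeGroup G] [MeasurableSpace G] [HaarData G] [RegularGaugeGroup G]
variable {𝓜 : GroupAverage G} {ℰ : LoopAverage G}

/-- **(0.17)/(0.19) AT THE PAPER'S OWN `T` AND `𝐆`, unfolded**: the tree's step predicate over `rtOpITwoLevel` with the
gauge-fixing density `gf017` reads `∃ N_k > 0, rnTransport Ū (χ_k e^{−𝐆/g_k² + A_k}) = N_k e^{A_{k+1}} ∧ A_{k+1}(1) = 0`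
(definitional). [cite: Balaban1987RG1, (0.19) p.255] -/
theorem smallFieldStepI_twoLevel_iff (hM : 𝓜.MeasurableM) (hE : ℰ.MeasurableE)
    (hac : HaarAC (avgFun₂ 𝓜 ℰ : GaugeField P j G → GaugeField P (j+1) G))
    (χ A : Density P j G) (gk : ℝ) (A' : Density P (j+1) G) :
    SmallFieldStepI (rtOpITwoLevel 𝓜 ℰ hM hE hac) χ (gf017 𝓜 Finset.univ) gk A A' ↔
      ∃ N : ℝ, 0 < N ∧
        rnTransport (avgFun₂ 𝓜 ℰ) (fun U => χ U * Real.exp (-(1 / gk ^ 2) * gf017 𝓜 Finset.univ U + A U))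
          = (fun V => N * Real.exp (A' V)) ∧ A' 1 = 0 :=
  Iff.rfl

/-- **THE WEAK (δ-FUNCTION) FORM OF (0.17)/(0.19)**: if `A_{k+1}` is a small-field step of `A_k` at print's `T_k` (any
gauge-fixing density `GF`, any cut-off `χ_k`) and the integrand is integrable, then for the normalization constant `N_k`
of the step and EVERY bounded measurable `f`,
`N_k ∫dV e^{A_{k+1}(V)} f(V) = ∫dU χ_k(U) e^{−GF(U)/g_k² + A_k(U)} f(Ū)` with `Ū` = (0.12) — print's
`e^{A_{k+1}(V)}·𝐍_k = ∫dU Π_c δ(Ū(c)V⁻¹(c)) χ_k exp[…]` integrated against test functions. [cite: Balaban1987RG1, (0.17) p.255, (0.19) p.255] -/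
theorem exists_integral_step_eq (hM : 𝓜.MeasurableM) (hE : ℰ.MeasurableE)
    (hac : HaarAC (avgFun₂ 𝓜 ℰ : GaugeField P j G → GaugeField P (j+1) G))
    {χ GF A : Density P j G} {gk : ℝ} {A' : Density P (j+1) G}
    (hstep : SmallFieldStepI (rtOpITwoLevel 𝓜 ℰ hM hE hac) χ GF gk A A')
    (hint : Integrable (fun U => χ U * Real.exp (-(1 / gk ^ 2) * GF U + A U)) (fieldMeasure P j G)) :
    ∃ N : ℝ, 0 < N ∧ A' 1 = 0 ∧
      ∀ f : GaugeField P (j+1) G → ℝ, Measurable f → (∃ C : ℝ, ∀ V, |f V| ≤ C) →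
        N * ∫ V, Real.exp (A' V) * f V ∂(fieldMeasure P (j+1) G)
          = ∫ U, (χ U * Real.exp (-(1 / gk ^ 2) * GF U + A U)) * f (avgFun₂ 𝓜 ℰ U) ∂(fieldMeasure P j G) := by
  obtain ⟨N, hN, hT, h1⟩ := hstep
  refine ⟨N, hN, h1, fun f hf hC => ?_⟩
  have h := (rtOpITwoLevel 𝓜 ℰ hM hE hac).isRT _ hint f hf hC
  have hT' : ∀ V, rnTransport (avgFun₂ 𝓜 ℰ) (fun U => χ U * Real.exp (-(1 / gk ^ 2) * GF U + A U)) V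
      = N * Real.exp (A' V) := fun V => congrFun hT V
  simp only [rtOpITwoLevel_T, hT', blockAvg₂_avg] at h
  rw [← integral_const_mul, ← h]
  refine integral_congr_ae (Filter.Eventually.of_forall fun V => ?_)
  simp only
  ring

/-- The total-mass instance (`f ≡ 1`): `N_k ∫dV e^{A_{k+1}(V)} = ∫dU χ_k(U) e^{−GF(U)/g_k² + A_k(U)}` (the normalization constant of (0.17)/(0.19) against the total integrals). [cite: Balaban1987RG1, (0.17) p.255] -/
theorem exists_integral_step_mass (hM : 𝓜.MeasurableM) (hE : ℰ.MeasurableE)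
    (hac : HaarAC (avgFun₂ 𝓜 ℰ : GaugeField P j G → GaugeField P (j+1) G))
    {χ GF A : Density P j G} {gk : ℝ} {A' : Density P (j+1) G}
    (hstep : SmallFieldStepI (rtOpITwoLevel 𝓜 ℰ hM hE hac) χ GF gk A A')
    (hint : Integrable (fun U => χ U * Real.exp (-(1 / gk ^ 2) * GF U + A U)) (fieldMeasure P j G)) :
    ∃ N : ℝ, 0 < N ∧ A' 1 = 0 ∧
      N * ∫ V, Real.exp (A' V) ∂(fieldMeasure P (j+1) G)
        = ∫ U, χ U * Real.exp (-(1 / gk ^ 2) * GF U + A U) ∂(fieldMeasure P j G) := by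
  obtain ⟨N, hN, h1, h⟩ := exists_integral_step_eq hM hE hac hstep hint
  refine ⟨N, hN, h1, ?_⟩
  have h' := h (fun _ => (1 : ℝ)) measurable_const ⟨1, fun _ => by simp⟩
  simpa using h'

/-- **Gauge invariance of the new action at print's `T` and print's `𝐆`** (p. 265 «The gauge covariance of the averages
implies that the δ-functions in (2.1) are invariant …»; p. 263 (1.10)): `A_{k+1}(V^v) = A_{k+1}(V)` for `dV`-a.e. `V`,
whenever `χ_k` and `A_k` are lift-invariant (the gauge-fixing density `gf017` is, `liftInvariant_gf017`) — the instance of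
`B12RTGaugeInvariance254.smallFieldStep_gaugeInvariant_ae`. [cite: Balaban1987RG1, (2.1) p.265] -/
theorem nextAction_gaugeInvariant_ae_twoLevel (hj : j + 1 ≤ P.m + P.K) (hM : 𝓜.MeasurableM) (hE : ℰ.MeasurableE)
    (hac : HaarAC (avgFun₂ 𝓜 ℰ : GaugeField P j G → GaugeField P (j+1) G))
    {χ A : Density P j G} {gk : ℝ} {A' : Density P (j+1) G}
    (hstep : SmallFieldStepI (rtOpITwoLevel 𝓜 ℰ hM hE hac) χ (gf017 𝓜 Finset.univ) gk A A')
    (hχ : LiftInvariant χ) (hA : LiftInvariant A)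
    (hint : Integrable (fun U => χ U * Real.exp (-(1 / gk ^ 2) * gf017 𝓜 Finset.univ U + A U)) (fieldMeasure P j G))
    (hint' : Integrable ((rtOpITwoLevel 𝓜 ℰ hM hE hac).T
      (fun U => χ U * Real.exp (-(1 / gk ^ 2) * gf017 𝓜 Finset.univ U + A U))) (fieldMeasure P (j+1) G))
    (v : GaugeTransf P (j+1) G) :
    (fun V => A' (GaugeField.gaugeAct v V)) =ᵐ[fieldMeasure P (j+1) G] A' :=
  smallFieldStep_gaugeInvariant_ae hj (rtOpITwoLevel 𝓜 ℰ hM hE hac) hstep hχ (liftInvariant_gf017 𝓜 hj _) hA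
    hint hint' v

end Step


/-! ## 5. (0.19) literally, at the paper's own objects: `A_{k+1} = log 𝐍_k⁻¹ T_k(χ_k e^{−𝐆/g_k² + A_k})` with print's `T_k`, `𝐆` -/

section Printed

open B12Eq019ActionBody

variable {P : Params} {j : ℕ} {G : Type*} [GaugeGroup G] [MeasurableSpace G] [HaarData G] [RegularGaugeGroup G]
variable (𝓜 : GroupAverage G) (ℰ : LoopAverage G)

/-- **(0.19) AT THE PAPER'S OWN OBJECTS — `A_{k+1}(g_{k+1}, V) = (𝐓_kA_k)(g_{k+1}, V) =
log 𝐍_k⁻¹ ∫dU Π_{c∈T⁽ᵏ⁺¹⁾} δ(Ū(c)V⁻¹(c)) χ_k exp[−(1/g_k²) Σ_{y∈T⁽ᵏ⁺¹⁾} Σ_{x∈B(y),x≠y} [1 − Re tr U(y,x)] + A_k(g_k,U)]`**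
with `Ū` = the two-level average (0.12), `U(y,x)` = the averaged contour variables (0.11), `𝐍_k` = «the integral above with
V = 1»: the body `B12Eq019ActionBody.nextAction` (the `log`/normalisation layer) AT print's renormalization transformation
`rtOpITwoLevel 𝓜 ℰ` (the δ-integral in the Radon–Nikodym reading, DIVERGENCE F7) and print's gauge-fixing density `gf017 𝓜`
(cut-off `χ_k` and coupling `g_k` parameters, as printed). [cite: Balaban1987RG1, (0.19) p.255] -/
def printedNextAction (hM : 𝓜.MeasurableM) (hE : ℰ.MeasurableE)
    (hac : HaarAC (avgFun₂ 𝓜 ℰ : GaugeField P j G → GaugeField P (j+1) G))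
    (χ : Density P j G) (gk : ℝ) (A : Density P j G) : Density P (j+1) G :=
  nextAction (rtOpITwoLevel 𝓜 ℰ hM hE hac).T χ (gf017 𝓜 Finset.univ) gk A

variable {𝓜 ℰ}

/-- Unfolded: `A_{k+1}(V) = log (𝐍_k⁻¹ · (rnTransport Ū (χ_k e^{−𝐆/g_k² + A_k}))(V))`, `Ū` = (0.12) (definitional).
[cite: Balaban1987RG1, (0.19) p.255] -/
theorem printedNextAction_apply (hM : 𝓜.MeasurableM) (hE : ℰ.MeasurableE)
    (hac : HaarAC (avgFun₂ 𝓜 ℰ : GaugeField P j G → GaugeField P (j+1) G))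
    (χ : Density P j G) (gk : ℝ) (A : Density P j G) (V : GaugeField P (j+1) G) :
    printedNextAction 𝓜 ℰ hM hE hac χ gk A V =
      Real.log ((normConst (rnTransport (avgFun₂ 𝓜 ℰ)) χ (gf017 𝓜 Finset.univ) gk A)⁻¹ *
        rnTransport (avgFun₂ 𝓜 ℰ) (integrand χ (gf017 𝓜 Finset.univ) gk A) V) := rfl

/-- The first form of the display, `A_{k+1} = 𝐓_kA_k`: `printedNextAction` IS r20's body at print's operator and density
(definitional). [cite: Balaban1987RG1, (0.19) p.255] -/
theorem printedNextAction_eq_nextAction (hM : 𝓜.MeasurableM) (hE : ℰ.MeasurableE)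
    (hac : HaarAC (avgFun₂ 𝓜 ℰ : GaugeField P j G → GaugeField P (j+1) G))
    (χ : Density P j G) (gk : ℝ) (A : Density P j G) :
    printedNextAction 𝓜 ℰ hM hE hac χ gk A = nextAction (rtOpITwoLevel 𝓜 ℰ hM hE hac).T χ (gf017 𝓜 Finset.univ) gk A :=
  rfl

/-- `A_{k+1}(1) = 0` at print's objects («𝐍_k … the integral above with V = 1»). [cite: Balaban1987RG1, (0.19) p.255] -/
@[simp] theorem printedNextAction_one (hM : 𝓜.MeasurableM) (hE : ℰ.MeasurableE)
    (hac : HaarAC (avgFun₂ 𝓜 ℰ : GaugeField P j G → GaugeField P (j+1) G))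
    (χ : Density P j G) (gk : ℝ) (A : Density P j G) :
    printedNextAction 𝓜 ℰ hM hE hac χ gk A 1 = 0 :=
  nextAction_one _ _ _ _ _

/-- **The cell's step predicate HOLDS at print's objects with print's `A_{k+1}`**, whenever the transformed density
`T_k(χ_k e^{−𝐆/g_k² + A_k})` is (strictly) positive — the hypothesis under which print's `log` is taken (print is silent;
the tree's `RTOpI.pos` gives only `≥ 0`). [cite: Balaban1987RG1, (0.19) p.255] -/
theorem smallFieldStepI_printedNextAction (hM : 𝓜.MeasurableM) (hE : ℰ.MeasurableE)
    (hac : HaarAC (avgFun₂ 𝓜 ℰ : GaugeField P j G → GaugeField P (j+1) G))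
    (χ : Density P j G) (gk : ℝ) (A : Density P j G)
    (hpos : ∀ V, 0 < (rtOpITwoLevel 𝓜 ℰ hM hE hac).T (integrand χ (gf017 𝓜 Finset.univ) gk A) V) :
    SmallFieldStepI (rtOpITwoLevel 𝓜 ℰ hM hE hac) χ (gf017 𝓜 Finset.univ) gk A (printedNextAction 𝓜 ℰ hM hE hac χ gk A) :=
  smallFieldStepI_nextAction _ χ _ gk A hpos

/-- **… and is FORCED**: any `A'` satisfying the cell's step predicate at print's objects IS print's `A_{k+1}`
(`B12Eq019ActionBody.eq_nextAction_of_smallFieldStepI` at print's operator). [cite: Balaban1987RG1, (0.19) p.255] -/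
theorem eq_printedNextAction_of_step (hM : 𝓜.MeasurableM) (hE : ℰ.MeasurableE)
    (hac : HaarAC (avgFun₂ 𝓜 ℰ : GaugeField P j G → GaugeField P (j+1) G))
    {χ A : Density P j G} {gk : ℝ} {A' : Density P (j+1) G}
    (h : SmallFieldStepI (rtOpITwoLevel 𝓜 ℰ hM hE hac) χ (gf017 𝓜 Finset.univ) gk A A') :
    A' = printedNextAction 𝓜 ℰ hM hE hac χ gk A :=
  eq_nextAction_of_smallFieldStepI h

/-- Hence at print's objects the step predicate is EQUIVALENT to: positivity of the transformed density and
`A' = A_{k+1}` as printed. [cite: Balaban1987RG1, (0.19) p.255] -/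
theorem smallFieldStepI_printed_iff (hM : 𝓜.MeasurableM) (hE : ℰ.MeasurableE)
    (hac : HaarAC (avgFun₂ 𝓜 ℰ : GaugeField P j G → GaugeField P (j+1) G))
    (χ A : Density P j G) (gk : ℝ) (A' : Density P (j+1) G) :
    SmallFieldStepI (rtOpITwoLevel 𝓜 ℰ hM hE hac) χ (gf017 𝓜 Finset.univ) gk A A' ↔
      (∀ V, 0 < (rtOpITwoLevel 𝓜 ℰ hM hE hac).T (integrand χ (gf017 𝓜 Finset.univ) gk A) V) ∧
        A' = printedNextAction 𝓜 ℰ hM hE hac χ gk A :=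
  smallFieldStepOp_iff _ χ _ gk A A'

end Printed

/-! ### 5b. The same on `SU(N)`, every `N ≥ 1`, no bracket -/

section PrintedSUN

open ExpMeanLog BlockAveragingEMLFibreLawSUN B12Eq019ActionBody

variable {N : ℕ} [NeZero N] {P : Params} {j : ℕ}

/-- **(0.19) on `SU(N)` with the printed outer average and any measurable inner `M`, hypothesis-free in the data**:
`A_{k+1} := log 𝐍_k⁻¹ T_k(χ_k e^{−𝐆/g_k² + A_k})` at `rtOpITwoLevelSUN`. [cite: Balaban1987RG1, (0.19) p.255] -/
def printedNextActionSUN (𝓜 : GroupAverage (Matrix.specialUnitaryGroup (Fin N) ℂ)) (hM : 𝓜.MeasurableM)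
    (hj : j + 1 ≤ P.m + P.K) (χ : Density P j (Matrix.specialUnitaryGroup (Fin N) ℂ)) (gk : ℝ)
    (A : Density P j (Matrix.specialUnitaryGroup (Fin N) ℂ)) : Density P (j+1) (Matrix.specialUnitaryGroup (Fin N) ℂ) :=
  printedNextAction 𝓜 expMeanLogSU hM measurable_expMeanLogSU_E (haarAC_avgFun₂_expMeanLogSU_SUN 𝓜 hj hM) χ gk A

/-- **(0.19) on `SU(N)` with BOTH printed averaging operations** (Federbush's inner mean (0.10), exp-mean-log outer).
[cite: Balaban1987RG1, (0.19) p.255] -/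
def printedNextActionFederbush (hj : j + 1 ≤ P.m + P.K) (χ : Density P j (Matrix.specialUnitaryGroup (Fin N) ℂ))
    (gk : ℝ) (A : Density P j (Matrix.specialUnitaryGroup (Fin N) ℂ)) :
    Density P (j+1) (Matrix.specialUnitaryGroup (Fin N) ℂ) :=
  printedNextActionSUN FederbushMean.federbushSU measurableM_federbushSU hj χ gk A

/-- It is the body at `rtOpITwoLevelFederbush` and the Federbush gauge-fixing density (definitional).
[cite: Balaban1987RG1, (0.19) p.255] -/
theorem printedNextActionFederbush_eq (hj : j + 1 ≤ P.m + P.K) (χ : Density P j (Matrix.specialUnitaryGroup (Fin N) ℂ))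
    (gk : ℝ) (A : Density P j (Matrix.specialUnitaryGroup (Fin N) ℂ)) :
    printedNextActionFederbush hj χ gk A =
      nextAction (rtOpITwoLevelFederbush (P := P) hj).T χ
        (gf017 (FederbushMean.federbushSU (n := Fin N)) Finset.univ) gk A := rfl

/-- `A_{k+1}(1) = 0` on `SU(N)` with both printed operations. [cite: Balaban1987RG1, (0.19) p.255] -/
@[simp] theorem printedNextActionFederbush_one (hj : j + 1 ≤ P.m + P.K)
    (χ : Density P j (Matrix.specialUnitaryGroup (Fin N) ℂ)) (gk : ℝ)
    (A : Density P j (Matrix.specialUnitaryGroup (Fin N) ℂ)) :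
    printedNextActionFederbush hj χ gk A 1 = 0 :=
  nextAction_one _ _ _ _ _

/-- The step at both printed operations holds with print's `A_{k+1}` under positivity, and is forced.
[cite: Balaban1987RG1, (0.19) p.255] -/
theorem smallFieldStepI_federbush_iff (hj : j + 1 ≤ P.m + P.K)
    (χ A : Density P j (Matrix.specialUnitaryGroup (Fin N) ℂ)) (gk : ℝ)
    (A' : Density P (j+1) (Matrix.specialUnitaryGroup (Fin N) ℂ)) :
    SmallFieldStepI (rtOpITwoLevelFederbush (P := P) hj) χ
        (gf017 (FederbushMean.federbushSU (n := Fin N)) Finset.univ) gk A A' ↔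
      (∀ V, 0 < (rtOpITwoLevelFederbush (P := P) hj).T
          (integrand χ (gf017 (FederbushMean.federbushSU (n := Fin N)) Finset.univ) gk A) V) ∧
        A' = printedNextActionFederbush hj χ gk A :=
  smallFieldStepOp_iff _ χ _ gk A A'

end PrintedSUN

end Literature.MathematicalPhysics.QuantumFieldTheory.Balaban1983to89.B12RT013TwoLevel
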